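import Summits.NavierStokesRegularity.NavierStokesRegularity.Theses.RootDecompFactorLadder
import Summits.NavierStokesRegularity.NavierStokesRegularity.Theorems.RootDecompFactorLadderRepresentativeWindow
import HarnessLib

/-!
# The continuous representative of a Type-I RDSS ancient mild solution (item REG of N26 / N15)

Route `RootDecompFactorLadder` (N26), support item `TypeIRdssRepresentative`
(stmt-NavierStokesRegularity-27745, shared verbatim with route `RootDecompThresholdSaddle`, N15):
every ancient mild solution `u` of Navier–Stokes (`ν = 1`, the tree's duality-form class
`IsAncientMildSolution`) with measurable slices, `(c, R)`-RDSS and Type-I decay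
`‖u(t,x)‖ ≤ C₀ / (‖x‖ + √(−t))` agrees, slice by slice a.e. on `t < 0`, with a representative `V`
of the same class which is jointly continuous on `(−∞, 0) × ℝ³`, vanishes on `t ≥ 0`, and is again
`(c, R)`-RDSS with Type-I decay.

## Proof (the window step is `Theorems/RootDecompFactorLadderRepresentativeWindow.lean`)

* **Weak-* continuity.** On every window `t < −δ` the solution is bounded (`C₀/√δ`); after the
  time shift `v = u(· − δ)` it is a bounded ancient mild solution on `(−∞, 0)` whose pairings with
  divergence-free tests are continuous in time (`AncientMildPairing`), and the decay
  `‖x‖ ‖v‖ ≤ C₀` pins the spatial constants, so `t ↦ ∫⟪v(t), θ⟫` is continuous for EVERY test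
  field `θ` (`AncientMildWeakStar.continuousOn_integral_inner_of_cylRadius_decay`).
* **A bounded weak solution in the class.** Hence `v` has a jointly measurable modification
  (`AncientMildRepresentative.exists_stronglyMeasurable_modification`), which after truncation is a
  bounded weak solution of Navier–Stokes on `ℝ³ × (−∞, 0)` in the sense of KNSS 2009, §4
  (`IsBoundedAncientMildSolution.isBoundedWeakNSSolutionOn`).
* **KNSS §4 regularity** (`KNSS2009_regularity_boundedWeak_window_holds`, PROVED in the tree) on
  the window `(−T−1, 0)`: `v = U + b(t)` a.e. on a.e. slice, with `U` smooth in `x`, bounded, and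
  Lipschitz in `t` uniformly in `x` on `(−T, 0)`; so `U` is jointly continuous there.
* **Pinning the constant.** `e(t) := Σᵢ (∫⟪v(t) − U(t), g bᵢ⟫) bᵢ` (`g` a unit-mass bump) is
  continuous in `t` (weak-* continuity) and equals `b(t)` at a.e. `t`; `V := U + e` is jointly
  continuous, `V(t) = v(t)` a.e. for a.e. `t`, and for EVERY `t` the pairings
  `∫⟪v(t) − V(t), θ⟫` are continuous in `t` and vanish a.e., hence vanish; a bounded field
  annihilating all test fields is zero a.e. (`ae_eq_zero_of_integral_contDiff_smul_eq_zero`).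
* **Gluing** the window representatives (two continuous slice representatives agree everywhere)
  and **transfer** of the class (slice-wise a.e. congruence), of RDSS and of the decay (both are
  closed conditions on continuous slices holding a.e.).

## References

* G. Koch, N. Nadirashvili, G. Seregin, V. Šverák, *Liouville theorems for the Navier–Stokes
  equations and applications*, Acta Math. 203 (2009) 83–105 = arXiv:0709.3599, §4 (regularity of
  bounded weak solutions), §1 p. 3 (the parasitic drift `b(t)`). [KochNadirashviliSereginSverak2009]
* D. Chae, J. Wolf, *On Liouville type theorems for the self-similar and discretely self-similar
  solutions*, ARMA 225 (2017) 549–573 = arXiv:1606.09535, Def. 1.1 (RDSS). [ChaeWolf2017]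
-/

noncomputable section

set_option linter.dupNamespace false

open MeasureTheory Set Function Filter Topology TopologicalSpace InnerProductSpace
open scoped RealInnerProductSpace NNReal ENNReal ContDiff
open Literature.Analysis Literature.Analysis.FluidPDE
open Summit.NavierStokesRegularity.NavierStokesRegularity.Theorems.RootDecompFactorLadderRepresentativeWindow

namespace Summit.NavierStokesRegularity.NavierStokesRegularity.Theorems.RootDecompFactorLadderRepresentative

/-- Local notation for physical space `ℝ³ = EuclideanSpace ℝ (Fin 3)`. -/
local notation "ℝ³" => EuclideanSpace ℝ (Fin 3)

/-! ### §2 Gluing: the continuous representative of a Type-I ancient mild solution -/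

/-- The window index: for `0 < s`, `n = ⌊1/s⌋₊ + ⌊4s⌋₊` has `1/(n+1) < s` and `4s < n + 5`. -/
theorem index_spec {s : ℝ} (hs : 0 < s) :
    1 / ((⌊1 / s⌋₊ + ⌊4 * s⌋₊ : ℕ) + 1 : ℝ) < s ∧ 4 * s < ((⌊1 / s⌋₊ + ⌊4 * s⌋₊ : ℕ) : ℝ) + 5 := by
  have h1 : 1 / s < ⌊1 / s⌋₊ + 1 := Nat.lt_floor_add_one _
  have h2 : 4 * s < ⌊4 * s⌋₊ + 1 := Nat.lt_floor_add_one _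
  have hc1 : (0 : ℝ) ≤ ⌊1 / s⌋₊ := Nat.cast_nonneg _
  have hc2 : (0 : ℝ) ≤ ⌊4 * s⌋₊ := Nat.cast_nonneg _
  push_cast
  constructor
  · rw [div_lt_iff₀ (by positivity)]
    have h3 : 1 < s * (⌊1 / s⌋₊ + 1) := by
      have := mul_lt_mul_of_pos_left h1 hs
      rwa [mul_one_div_cancel hs.ne'] at this
    nlinarith
  · linarith

/-- Membership in the `n`-th window `(−(n+5) − 1/(n+1), −1/(n+1))` from the two index bounds. -/
theorem mem_window {n : ℕ} {t : ℝ} (h1 : 1 / ((n : ℝ) + 1) < -t) (h2 : -t < (n : ℝ) + 5) :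
    t ∈ Ioo (-((n : ℝ) + 5) - 1 / ((n : ℝ) + 1)) (-(1 / ((n : ℝ) + 1))) := by
  have h3 : 0 < 1 / ((n : ℝ) + 1) := by positivity
  exact ⟨by linarith, by linarith⟩

/-- **The continuous representative.** An ancient mild solution (`ν = 1`) with measurable slices and
Type-I decay has a representative jointly continuous on `(−∞, 0) × ℝ³`, equal to `u(t)` a.e. for
EVERY `t < 0` (window representatives of the bounded time shifts `u(· − 1/(n+1))`, glued: two
continuous slice representatives agree everywhere). -/
theorem exists_continuousOn_representative {u : ℝ → ℝ³ → ℝ³} (hu : IsAncientMildSolution 1 u)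
    (hmeas : ∀ t < 0, AEStronglyMeasurable (u t) volume) {C₀ : ℝ} (hC₀ : HasTypeIDecay C₀ u) :
    ∃ V : ℝ → ℝ³ → ℝ³, ContinuousOn (uncurry V) (Iio 0 ×ˢ univ) ∧ ∀ t < 0, V t =ᵐ[volume] u t := by
  have hC₀nn : 0 ≤ C₀ := by
    have h := hC₀ (-1) (by norm_num) 0
    rw [norm_zero, zero_add, neg_neg, Real.sqrt_one, div_one] at h
    exact (norm_nonneg _).trans h
  -- the window representatives
  have key : ∀ n : ℕ, ∃ W : ℝ → ℝ³ → ℝ³,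
      ContinuousOn (uncurry W)
        (Ioo (-((n : ℝ) + 5) - 1 / ((n : ℝ) + 1)) (-(1 / ((n : ℝ) + 1))) ×ˢ univ) ∧
      ∀ t ∈ Ioo (-((n : ℝ) + 5) - 1 / ((n : ℝ) + 1)) (-(1 / ((n : ℝ) + 1))),
        W t =ᵐ[volume] u t := by
    intro n
    set δ : ℝ := 1 / ((n : ℝ) + 1) with hδ_def
    have hδ : 0 < δ := by positivity
    set v : ℝ → ℝ³ → ℝ³ := fun t => u (t + -δ) with hv_def
    have hsq : ∀ t < 0, Real.sqrt δ ≤ Real.sqrt (-(t + -δ)) := fun t ht =>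
      Real.sqrt_le_sqrt (by linarith)
    have hv : IsBoundedAncientMildSolution 1 v := by
      refine ⟨hu.time_translate (by linarith), C₀ / Real.sqrt δ, fun t ht x => ?_⟩
      have ht' : (t : ℝ) < 0 := ht
      refine (hC₀ (t + -δ) (by linarith) x).trans ?_
      exact div_le_div_of_nonneg_left hC₀nn (Real.sqrt_pos.2 hδ)
        ((hsq t ht').trans (le_add_of_nonneg_left (norm_nonneg _)))
    have hvmeas : ∀ t < 0, AEStronglyMeasurable (v t) volume := fun t ht => hmeas _ (by linarith)
    have hvC : ∀ t < 0, ∀ x, ‖x‖ * ‖v t x‖ ≤ C₀ := by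
      intro t ht x
      have hs : 0 < Real.sqrt (-(t + -δ)) := Real.sqrt_pos.2 (by linarith)
      have h := hC₀ (t + -δ) (by linarith) x
      calc ‖x‖ * ‖v t x‖ ≤ ‖x‖ * (C₀ / (‖x‖ + Real.sqrt (-(t + -δ)))) :=
            mul_le_mul_of_nonneg_left h (norm_nonneg x)
        _ = C₀ * (‖x‖ / (‖x‖ + Real.sqrt (-(t + -δ)))) := by ring
        _ ≤ C₀ * 1 := mul_le_mul_of_nonneg_left
            (div_le_one_of_le₀ (by linarith) (by positivity)) hC₀nn
        _ = C₀ := mul_one _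
    obtain ⟨Vn, hVnc, hVnv⟩ := exists_window_rep hv hvmeas hvC ((n : ℝ) + 5) (by positivity)
    refine ⟨fun t => Vn (t + δ), ?_, fun t ht => ?_⟩
    · have hmaps : MapsTo (fun p : ℝ × ℝ³ => (p.1 + δ, p.2))
          (Ioo (-((n : ℝ) + 5) - δ) (-δ) ×ˢ univ) (Ioo (-((n : ℝ) + 5)) 0 ×ˢ univ) := by
        intro p hp
        have hp1 := (mem_prod.1 hp).1
        exact mem_prod.2 ⟨⟨by linarith [hp1.1], by linarith [hp1.2]⟩, mem_univ _⟩
      have hcont : Continuous fun p : ℝ × ℝ³ => (p.1 + δ, p.2) := by fun_prop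
      exact (hVnc.comp hcont.continuousOn hmaps).congr fun p _ => rfl
    · have h := hVnv (t + δ) ⟨by linarith [ht.1], by linarith [ht.2]⟩
      have hv' : v (t + δ) = u t := by
        simp only [hv_def, add_neg_cancel_right]
      rw [hv'] at h
      exact h
  choose W hWc hWu using key
  -- two continuous slice representatives agree everywhere
  have hagree : ∀ (m n : ℕ) (t : ℝ),
      t ∈ Ioo (-((m : ℝ) + 5) - 1 / ((m : ℝ) + 1)) (-(1 / ((m : ℝ) + 1))) →
      t ∈ Ioo (-((n : ℝ) + 5) - 1 / ((n : ℝ) + 1)) (-(1 / ((n : ℝ) + 1))) → W m t = W n t :=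
    fun m n t hm hn =>
      (Continuous.ae_eq_iff_eq volume (continuous_slice (hWc m) hm) (continuous_slice (hWc n) hn)).1
        ((hWu m t hm).trans (hWu n t hn).symm)
  -- the glued representative
  set N : ℝ → ℕ := fun t => ⌊1 / (-t)⌋₊ + ⌊4 * (-t)⌋₊ with hN_def
  have hNmem : ∀ t < 0, t ∈ Ioo (-((N t : ℝ) + 5) - 1 / ((N t : ℝ) + 1)) (-(1 / ((N t : ℝ) + 1))) :=
    fun t ht => by
      have h : 1 / ((N t : ℝ) + 1) < -t ∧ 4 * (-t) < (N t : ℝ) + 5 := index_spec (neg_pos.2 ht)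
      exact mem_window h.1 (by linarith [h.2])
  refine ⟨fun t x => W (N t) t x, fun p hp => ?_, fun t ht => hWu (N t) t (hNmem t ht)⟩
  -- continuity at `p`: on `(2 t₀, t₀/2) × ℝ³` the glued field is `W m`, `m` the index of `-t₀/2`
  have ht₀ : p.1 < 0 := (mem_prod.1 hp).1
  set m : ℕ := ⌊1 / (-p.1 / 2)⌋₊ + ⌊4 * (-p.1 / 2)⌋₊ with hm_def
  have hmspec : 1 / ((m : ℝ) + 1) < -p.1 / 2 ∧ 4 * (-p.1 / 2) < (m : ℝ) + 5 :=
    index_spec (s := -p.1 / 2) (by linarith)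
  set O : Set (ℝ × ℝ³) := Ioo (2 * p.1) (p.1 / 2) ×ˢ univ with hO_def
  have hO : IsOpen O := isOpen_Ioo.prod isOpen_univ
  have hpO : p ∈ O := mem_prod.2 ⟨⟨by linarith, by linarith⟩, mem_univ _⟩
  have hOm : ∀ q ∈ O, q.1 ∈ Ioo (-((m : ℝ) + 5) - 1 / ((m : ℝ) + 1)) (-(1 / ((m : ℝ) + 1))) :=
    fun q hq => by
      have hq1 := (mem_prod.1 hq).1
      exact mem_window (by linarith [hmspec.1, hq1.2]) (by linarith [hmspec.2, hq1.1])
  have hEq : EqOn (fun q : ℝ × ℝ³ => W (N q.1) q.1 q.2) (uncurry (W m)) O := fun q hq => by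
    have hq0 : q.1 < 0 := by
      have hq1 := (mem_prod.1 hq).1
      linarith [hq1.2]
    show W (N q.1) q.1 q.2 = W m q.1 q.2
    rw [hagree (N q.1) m q.1 (hNmem q.1 hq0) (hOm q hq)]
  have hWm : ContinuousOn (uncurry (W m)) O :=
    (hWc m).mono
      (prod_mono (fun t ht => hOm (t, (0 : ℝ³)) (mem_prod.2 ⟨ht, mem_univ _⟩)) Subset.rfl)
  exact ((hWm.congr hEq).continuousAt (hO.mem_nhds hpO)).continuousWithinAt

/-! ### §3 Transfer of the class, of RDSS and of the decay; the item -/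

/-- **Transfer.** A jointly continuous slice-wise a.e. representative on `t < 0`, extended by `0` to
`t ≥ 0`, has every property asked by `TypeIRdssRepresentative`. -/
theorem rep_conclusion {c : ℝ} {R : ℝ³ ≃ₗᵢ[ℝ] ℝ³} {u V : ℝ → ℝ³ → ℝ³} (hc : 1 < c)
    (hu : IsAncientMildSolution 1 u) (hmeas : ∀ t < 0, AEStronglyMeasurable (u t) volume)
    (hdss : IsRotatedDSS c R u) {C₀ : ℝ} (hdecay : HasTypeIDecay C₀ u)
    (hVc : ContinuousOn (uncurry V) (Iio 0 ×ˢ univ)) (hVu : ∀ t < 0, V t =ᵐ[volume] u t) :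
    ∃ W : ℝ → ℝ³ → ℝ³, (∀ t : ℝ, t < 0 → W t =ᵐ[volume] u t) ∧ IsAncientMildSolution 1 W ∧
      (∀ t : ℝ, t < 0 → AEStronglyMeasurable (W t) volume) ∧
      ContinuousOn (uncurry W) (Iio 0 ×ˢ univ) ∧ (∀ t : ℝ, 0 ≤ t → W t = 0) ∧
      IsRotatedDSS c R W ∧ ∃ C₀ : ℝ, HasTypeIDecay C₀ W := by
  set W : ℝ → ℝ³ → ℝ³ := fun t x => if t < 0 then V t x else 0 with hW_def
  have hWV : ∀ t < 0, W t = V t := fun t ht => funext fun x => if_pos ht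
  have hW0 : ∀ t : ℝ, 0 ≤ t → W t = 0 := fun t ht => funext fun x => if_neg (not_lt.2 ht)
  have hWu : ∀ t < 0, W t =ᵐ[volume] u t := fun t ht => by
    rw [hWV t ht]
    exact hVu t ht
  have hWc : ContinuousOn (uncurry W) (Iio 0 ×ˢ univ) :=
    hVc.congr fun p hp => by
      show W p.1 p.2 = V p.1 p.2
      rw [hWV p.1 (mem_prod.1 hp).1]
  have hslice : ∀ t < 0, Continuous (W t) := fun t ht => continuous_slice hWc (S := Iio 0) ht
  have hc0 : (0 : ℝ) < c := by linarith
  refine ⟨W, hWu, isAncientMildSolution_congr_ae hu hWu,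
    fun t ht => (hmeas t ht).congr (hWu t ht).symm, hWc, hW0, fun t x => ?_, C₀, fun t ht x => ?_⟩
  · -- RDSS: for `t < 0` both sides are continuous in `x` and agree a.e.
    by_cases ht : t < 0
    · have hct : c ^ 2 * t < 0 := mul_neg_of_pos_of_neg (by positivity) ht
      have hφc : Continuous fun y : ℝ³ => c • R y := R.continuous.const_smul c
      have hφq : Measure.QuasiMeasurePreserving (fun y : ℝ³ => c • R y) volume volume :=
        (Measure.quasiMeasurePreserving_smul (volume : Measure ℝ³) hc0.ne').comp
          R.measurePreserving.quasiMeasurePreserving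
      have hL : Continuous fun y : ℝ³ => c • R.symm (W (c ^ 2 * t) (c • R y)) :=
        (R.symm.continuous.comp ((hslice _ hct).comp hφc)).const_smul c
      have hae : (fun y : ℝ³ => c • R.symm (W (c ^ 2 * t) (c • R y))) =ᵐ[volume] W t := by
        have h1 : (fun y : ℝ³ => W (c ^ 2 * t) (c • R y)) =ᵐ[volume]
            fun y => u (c ^ 2 * t) (c • R y) := hφq.ae_eq_comp (hWu _ hct)
        filter_upwards [h1, hWu t ht] with y hy hy'
        rw [hy, hy']
        exact hdss t y
      exact congrFun ((Continuous.ae_eq_iff_eq volume hL (hslice t ht)).1 hae) x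
    · have ht' : 0 ≤ t := not_lt.1 ht
      have hct : 0 ≤ c ^ 2 * t := mul_nonneg (by positivity) ht'
      rw [hW0 t ht', hW0 _ hct]
      simp
  · -- decay: a closed condition on the continuous slice, holding a.e.
    have hs : 0 < Real.sqrt (-t) := Real.sqrt_pos.2 (by linarith)
    have hgc : Continuous fun y : ℝ³ => C₀ / (‖y‖ + Real.sqrt (-t)) :=
      continuous_const.div (continuous_norm.add continuous_const) fun y =>
        (add_pos_of_nonneg_of_pos (norm_nonneg _) hs).ne'
    have hFc : Continuous fun y : ℝ³ => max ‖W t y‖ (C₀ / (‖y‖ + Real.sqrt (-t))) :=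
      (hslice t ht).norm.max hgc
    have hae : (fun y : ℝ³ => max ‖W t y‖ (C₀ / (‖y‖ + Real.sqrt (-t)))) =ᵐ[volume]
        fun y => C₀ / (‖y‖ + Real.sqrt (-t)) := by
      filter_upwards [hWu t ht] with y hy
      rw [hy]
      exact max_eq_right (hdecay t ht y)
    have h := congrFun ((Continuous.ae_eq_iff_eq volume hFc hgc).1 hae) x
    exact (le_max_left _ _).trans h.le

/-- **Item REG (`TypeIRdssRepresentative`, stmt-NavierStokesRegularity-27745) holds.** -/
theorem typeIRdssRepresentative_holds : Theses.RootDecompFactorLadder.TypeIRdssRepresentative := by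
  intro c R u hc hu hmeas hdss hdecay
  obtain ⟨C₀, hC₀⟩ := hdecay
  obtain ⟨V, hVc, hVu⟩ := exists_continuousOn_representative hu hmeas hC₀
  exact rep_conclusion hc hu hmeas hdss hC₀ hVc hVu

/-- The same theorem closes the verbatim copy on route `RootDecompThresholdSaddle` (N15). -/
theorem typeIRdssRepresentative_holds' : Theses.RootDecompThresholdSaddle.TypeIRdssRepresentative :=
  typeIRdssRepresentative_holds

end Summit.NavierStokesRegularity.NavierStokesRegularity.Theorems.RootDecompFactorLadderRepresentative

end
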